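import Literature.AlgebraicGeometry.Frobenioids.ProfiniteUnitsProofs
import HarnessLib

/-!
# Frobenioids I, Definition 2.8 (ii), (iii): the pro-`l` decomposition and the `ζ`-th power maps — proofs

Mochizuki, *The geometry of Frobenioids I*, Kyushu J. Math. **62** (2008), Definition 2.8,
kurims pp. 52–53 [cite: MochizukiFrdI2008, Def. 2.8 p.52].  This file discharges the three named
statements of `ProfiniteUnits.lean` concerning a topologically finitely generated profinite abelian
group `M` (written multiplicatively):

* `ProLDecomposition_holds` — Def. 2.8 (ii): "`M` decomposes as a direct product of pro-`l` groups
  `M[l]`": every `x` is, uniquely, the unconditionally convergent product `∏'_l x_l` of elements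
  `x_l ∈ M[l]`.  The component `x_l` is the profinite power `x ^ ε_l`, `ε_l ∈ Ẑ` the `l`-primary
  idempotent (`ProfiniteUnitsProofs.exists_compatible_hom`).
* `ZetaPowerMapExistsUnique_holds` — Def. 2.8 (iii): the map "raising to the `ζ`-th power"
  (continuous endomorphism equal to the `ζ(l)`-th power on each `M[l]`) exists and is unique; it
  is `x ↦ x ^ z_ζ` for the element `z_ζ = (ζ(l))_l ∈ ∏_l ℤ_l = Ẑ`.
* `ZetaPowerMapBijectiveOfCoprime_holds` — Def. 2.8 (iii), bracket: if `ζ(l)` is prime to `l` for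
  every `l`, this map is bijective (`z_ζ ∈ Ẑ^×`).

Only compactness, total disconnectedness and commutativity of `M` are used (topological finite
generation is not needed for (ii), (iii)).  No new definitions (theorems only).
-/

namespace Literature.AlgebraicGeometry.Frobenioids

open _root_.Topology Filter

universe u

section Decomposition

variable {M : Type u} [CommGroup M] [TopologicalSpace M]

/-- Membership in the pro-`l` portion `M[l]`, unfolded. [cite: MochizukiFrdI2008, Def. 2.8(ii) p.52] -/
theorem mem_proL_iff {l : Nat.Primes} {x : M} :
    x ∈ proL M l ↔ ∀ U : OpenSubgroup M, ∃ n : ℕ, x ^ ((l : ℕ) ^ n) ∈ U := Iff.rfl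

namespace IsTfgProfinite

/-- An element of `M[l]` dies in `M/U` after raising to the `l`-part of `[M : U]`.
[cite: MochizukiFrdI2008, Def. 2.8(ii) p.52] -/
theorem pow_ordProj_index_mem (h : IsTfgProfinite M) {l : Nat.Primes} {y : M}
    (hy : y ∈ proL M l) (U : OpenSubgroup M) :
    y ^ ordProj[(l : ℕ)] (U : Subgroup M).index ∈ U := by
  obtain ⟨n, hn⟩ := mem_proL_iff.mp hy U
  have hg := pow_gcd_mem U hn (pow_index_mem U y)
  obtain ⟨j, -, hj⟩ :=
    (Nat.dvd_prime_pow l.2).mp (Nat.gcd_dvd_left ((l : ℕ) ^ n) (U : Subgroup M).index)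
  have hdvd : (l : ℕ) ^ j ∣ ordProj[(l : ℕ)] (U : Subgroup M).index := by
    rw [← l.2.pow_dvd_iff_dvd_ordProj (h.index_ne_zero U), ← hj]
    exact Nat.gcd_dvd_right _ _
  obtain ⟨k, hk⟩ := hdvd
  rw [hk, pow_mul, ← hj]
  exact U.pow_mem hg k

/-- An element of `M[l]` dies in `M/U` after raising to the prime-to-`p` part of `[M : U]`, for any
prime `p ≠ l`. [cite: MochizukiFrdI2008, Def. 2.8(ii) p.52] -/
theorem pow_ordCompl_index_mem (h : IsTfgProfinite M) {l p : Nat.Primes} {y : M}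
    (hy : y ∈ proL M l) (hne : l ≠ p) (U : OpenSubgroup M) :
    y ^ ordCompl[(p : ℕ)] (U : Subgroup M).index ∈ U := by
  obtain ⟨k, hk⟩ :=
    ordProj_dvd_ordCompl_of_ne l.2 (fun h' => hne (Subtype.ext h')) (h.index_ne_zero U)
  rw [hk, pow_mul]
  exact U.pow_mem (h.pow_ordProj_index_mem hy U) k

end IsTfgProfinite

variable (M) in
/-- **Def. 2.8 (ii), proved: the pro-`l` decomposition `M = ∏_l M[l]`.**  For a topologically
finitely generated profinite abelian group `M` and `x ∈ M` there is a unique family `(x_l)_l`,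
`x_l ∈ M[l]`, whose unconditional product converges to `x`.  Existence: `x_l := x ^ ε_l` with
`ε_l ∈ Ẑ` the compatible system of `l`-primary idempotents (`exists_compatible_hom`); the partial
products converge to `x` because the idempotents of the primes dividing `[M:U]` sum to `1 (mod [M:U])`.
Uniqueness: modulo an open `U`, raising a convergent product to the `ε_{l₀}`-th power kills every
`M[l]`, `l ≠ l₀`, and fixes `M[l₀]`. [cite: MochizukiFrdI2008, Def. 2.8(ii) p.52] -/
theorem ProLDecomposition_holds : ProLDecomposition M := by
  classical
  intro h x
  haveI := h.isTopologicalGroup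
  haveI := h.t2Space
  choose e he using fun (l : Nat.Primes) (n : ℕ) => exists_primary_idempotent l.2 n
  have hcompat : ∀ l : Nat.Primes, ∀ n m : ℕ, n ≠ 0 → m ≠ 0 → n ∣ m → e l m ≡ e l n [MOD n] :=
    fun l n m _ hm hnm => primary_idempotent_modEq hm hnm (he l n) (he l m) l.2
  choose F hFc hF using fun l : Nat.Primes => h.exists_compatible_hom (hcompat l)
  -- the characterisation of `F l` in the finite quotients `M / U`
  have hFq : ∀ (l : Nat.Primes) (y : M) (U : OpenSubgroup M),
      (QuotientGroup.mk (F l y) : M ⧸ (U : Subgroup M)) =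
        QuotientGroup.mk y ^ e l (U : Subgroup M).index := by
    intro l y U
    have := hF l y U
    rw [← OpenSubgroup.mem_toSubgroup, ← QuotientGroup.eq] at this
    rw [← this, QuotientGroup.mk_pow]
  -- (1) the components lie in the pro-`l` portions
  have hmem : ∀ l, F l x ∈ proL M l := by
    intro l
    rw [mem_proL_iff]
    intro U
    refine ⟨((U : Subgroup M).index).factorization l, ?_⟩
    rw [← OpenSubgroup.mem_toSubgroup, ← QuotientGroup.eq_one_iff, QuotientGroup.mk_pow, hFq,
      ← pow_mul, ← QuotientGroup.mk_pow, QuotientGroup.eq_one_iff, OpenSubgroup.mem_toSubgroup]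
    refine IsTfgProfinite.pow_mem_of_index_dvd U x ?_
    have hdvd : ordProj[(l : ℕ)] (U : Subgroup M).index * ordCompl[(l : ℕ)] (U : Subgroup M).index ∣
        ordProj[(l : ℕ)] (U : Subgroup M).index * e l (U : Subgroup M).index :=
      Nat.mul_dvd_mul_left _ (Nat.modEq_zero_iff_dvd.mp (he l _).2)
    rwa [Nat.ordProj_mul_ordCompl_eq_self, mul_comm] at hdvd
  -- (2) the partial products converge to `x`
  have hprod : HasProd (fun l => F l x) x := by
    rw [HasProd, SummationFilter.unconditional_filter, tendsto_atTop']
    intro W hW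
    obtain ⟨U, hU⟩ := h.exists_openSubgroup_mul_subset hW
    have hN := h.index_ne_zero U
    refine ⟨((U : Subgroup M).index.primeFactors).subtype Nat.Prime, fun s hs => ?_⟩
    have key : x⁻¹ * ∏ l ∈ s, F l x ∈ U := by
      rw [← OpenSubgroup.mem_toSubgroup, ← QuotientGroup.eq, QuotientGroup.mk_prod]
      simp_rw [hFq]
      rw [Finset.prod_pow_eq_pow_sum, ← QuotientGroup.mk_pow,
        show (QuotientGroup.mk x : M ⧸ (U : Subgroup M)) = QuotientGroup.mk (x ^ 1) by rw [pow_one]]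
      refine IsTfgProfinite.mk_pow_eq_mk_pow_of_modEq U x
        (sum_primary_idempotent_modEq_one hN s ?_ _ fun l _ => he l _).symm
      intro p hp hpn
      exact ⟨hp, hs (Finset.mem_subtype.mpr (Nat.mem_primeFactors.mpr ⟨hp, hpn, hN⟩))⟩
    simpa only [mul_inv_cancel_left] using hU _ key
  refine ⟨fun l => F l x, ⟨hmem, hprod.multipliable, hprod.tprod_eq⟩, ?_⟩
  -- (3) uniqueness
  rintro g ⟨hg, hgm, hgx⟩
  have hgp : HasProd g x := hgx ▸ hgm.hasProd
  funext l₀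
  refine h.eq_of_forall_inv_mul_mem fun U => ?_
  have hev : ∀ᶠ s : Finset Nat.Primes in atTop, x⁻¹ * ∏ l ∈ s, g l ∈ U := by
    have hopen : IsOpen ((fun y => x⁻¹ * y) ⁻¹' (U : Set M)) :=
      U.isOpen.preimage (continuous_const.mul continuous_id)
    have hxU : x ∈ (fun y => x⁻¹ * y) ⁻¹' (U : Set M) := by
      show x⁻¹ * x ∈ (U : Set M)
      rw [inv_mul_cancel]
      exact U.one_mem
    rw [HasProd, SummationFilter.unconditional_filter] at hgp
    exact hgp.eventually_mem (hopen.mem_nhds hxU)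
  obtain ⟨s, hs₁, hs₂⟩ := (hev.and (eventually_ge_atTop ({l₀} : Finset Nat.Primes))).exists
  have hl₀ : l₀ ∈ s := hs₂ (Finset.mem_singleton_self l₀)
  rw [← OpenSubgroup.mem_toSubgroup, ← QuotientGroup.eq] at hs₁ ⊢
  have H1 : (QuotientGroup.mk (g l₀) : M ⧸ (U : Subgroup M)) ^ e l₀ (U : Subgroup M).index =
      QuotientGroup.mk (g l₀) ^ 1 := by
    refine pow_eq_pow_iff_modEq.mpr ((he l₀ _).1.of_dvd (orderOf_dvd_of_pow_eq_one ?_))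
    rw [← QuotientGroup.mk_pow, QuotientGroup.eq_one_iff]
    exact h.pow_ordProj_index_mem (hg l₀) U
  have H2 : ∀ l ∈ s.erase l₀,
      (QuotientGroup.mk (g l) : M ⧸ (U : Subgroup M)) ^ e l₀ (U : Subgroup M).index = 1 := by
    intro l hl
    obtain ⟨k, hk⟩ := Nat.modEq_zero_iff_dvd.mp (he l₀ (U : Subgroup M).index).2
    rw [hk, pow_mul, ← QuotientGroup.mk_pow, (QuotientGroup.eq_one_iff _).mpr
      (h.pow_ordCompl_index_mem (hg l) (Finset.ne_of_mem_erase hl) U), one_pow]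
  rw [hFq, hs₁, QuotientGroup.mk_prod, ← Finset.prod_pow, ← Finset.mul_prod_erase s _ hl₀, H1,
    Finset.prod_eq_one H2, pow_one, mul_one]

end Decomposition

section ZetaPower

variable {M : Type u} [CommGroup M] [TopologicalSpace M] (ζ : Nat.Primes → ℕ+)

namespace IsTfgProfinite

/-- **Construction of the `ζ`-th power map** (Def. 2.8 (iii)): there are compatible exponents
`Z(n) ≡ ζ(p) (mod p^{v_p(n)})` (all primes `p`) — i.e. the element `(ζ(p))_p ∈ ∏_p ℤ_p = Ẑ` — and
the profinite power `f = (x ↦ x ^ Z)` is a continuous endomorphism with `f x ≡ x ^ Z([M:U]) (mod U)`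
which is the `ζ(l)`-th power on each `M[l]`. [cite: MochizukiFrdI2008, Def. 2.8(iii) p.52] -/
theorem exists_zetaPowerMap (h : IsTfgProfinite M) :
    ∃ (Z : ℕ → ℕ) (f : M →* M),
      (∀ (n : ℕ) (p : Nat.Primes), Z n ≡ (ζ p : ℕ) [MOD ordProj[(p : ℕ)] n]) ∧
      (∀ (x : M) (U : OpenSubgroup M), (x ^ Z (U : Subgroup M).index)⁻¹ * f x ∈ U) ∧
      IsZetaPowerMap M ζ f := by
  choose Z hZ using fun n => exists_modEq_forall_prime n (fun p => (ζ p : ℕ))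
  have hZc : ∀ n m : ℕ, n ≠ 0 → m ≠ 0 → n ∣ m → Z m ≡ Z n [MOD n] := fun n m hn hm hnm =>
    modEq_of_forall_prime hn fun p hp =>
      ((hZ m ⟨p, hp⟩).of_dvd (Nat.ordProj_dvd_ordProj_of_dvd hm hnm p)).trans (hZ n ⟨p, hp⟩).symm
  obtain ⟨f, hfc, hf⟩ := h.exists_compatible_hom hZc
  refine ⟨Z, f, hZ, hf, ⟨hfc, map_mul f, ?_⟩⟩
  intro l x hx
  refine h.eq_of_forall_inv_mul_mem fun U => ?_
  have h1 := hf x U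
  rw [← OpenSubgroup.mem_toSubgroup, ← QuotientGroup.eq] at h1 ⊢
  rw [← h1, QuotientGroup.mk_pow, QuotientGroup.mk_pow]
  refine pow_eq_pow_iff_modEq.mpr ((hZ _ l).of_dvd (orderOf_dvd_of_pow_eq_one ?_))
  rw [← QuotientGroup.mk_pow, QuotientGroup.eq_one_iff]
  exact h.pow_ordProj_index_mem hx U

variable {ζ} in
/-- **Uniqueness of the `ζ`-th power map** (Def. 2.8 (iii)): two continuous endomorphisms that are
the `ζ(l)`-th power on every `M[l]` agree — they agree on each factor of the convergent product
`x = ∏'_l x_l` (`ProLDecomposition_holds`). [cite: MochizukiFrdI2008, Def. 2.8(iii) p.52] -/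
theorem zetaPowerMap_unique (h : IsTfgProfinite M) {f g : M → M}
    (hf : IsZetaPowerMap M ζ f) (hg : IsZetaPowerMap M ζ g) : f = g := by
  classical
  haveI := h.t2Space
  funext x
  obtain ⟨c, ⟨hc, hcm, hcx⟩, -⟩ := ProLDecomposition_holds M h x
  have hcp : HasProd c x := hcx ▸ hcm.hasProd
  let F : M →* M := MonoidHom.mk' f hf.map_mul
  let G : M →* M := MonoidHom.mk' g hg.map_mul
  have h1 : HasProd (F ∘ c) (f x) := hcp.map F hf.continuous
  have h2 : HasProd (G ∘ c) (g x) := hcp.map G hg.continuous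
  have hFG : (F ∘ c) = (G ∘ c) := by
    funext l
    simp only [Function.comp_apply, F, G, MonoidHom.mk'_apply]
    rw [hf.eq_pow l (c l) (hc l), hg.eq_pow l (c l) (hc l)]
  rw [hFG] at h1
  exact h1.unique h2

end IsTfgProfinite

variable (M) in
/-- **Def. 2.8 (iii), proved: existence and uniqueness of "raising to the `ζ`-th power".**
For a topologically finitely generated profinite abelian group `M` and `ζ : Primes → ℕ_{≥1}` there
is exactly one continuous endomorphism of `M` restricting to the `ζ(l)`-th power map on each
pro-`l` portion `M[l]`. [cite: MochizukiFrdI2008, Def. 2.8(iii) p.52] -/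
theorem ZetaPowerMapExistsUnique_holds : ZetaPowerMapExistsUnique M ζ := by
  intro h
  obtain ⟨Z, f, -, -, hf⟩ := h.exists_zetaPowerMap ζ
  exact ⟨f, hf, fun g hg => h.zetaPowerMap_unique hg hf⟩

variable (M) in
/-- **Def. 2.8 (iii), bracket, proved: "if `ζ` is of co-prime type, then the map given by raising
to the `ζ`-th power will always be bijective."**  Injectivity: modulo every open `U` the exponent
`Z([M:U])` is prime to `[M:U]`.  Surjectivity: the image is compact, hence closed, and dense
(`y ≡ f(y^a) (mod U)` for `a` an inverse of `Z([M:U])` modulo `[M:U]`).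
[cite: MochizukiFrdI2008, Def. 2.8(iii) p.53] -/
theorem ZetaPowerMapBijectiveOfCoprime_holds : ZetaPowerMapBijectiveOfCoprime M ζ := by
  classical
  intro h hζ g hg
  haveI := h.isTopologicalGroup
  haveI := h.compactSpace
  haveI := h.t2Space
  obtain ⟨Z, f, hZ, hf, hfz⟩ := h.exists_zetaPowerMap ζ
  obtain rfl : g = ⇑f := h.zetaPowerMap_unique hg hfz
  have hcop : ∀ U : OpenSubgroup M,
      Nat.Coprime (Z (U : Subgroup M).index) (U : Subgroup M).index := by
    intro U
    refine Nat.Coprime.symm (Nat.coprime_of_dvd fun p hp hpN hpZ => ?_)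
    have hmod : Z (U : Subgroup M).index ≡ (ζ ⟨p, hp⟩ : ℕ) [MOD p] :=
      (hZ _ ⟨p, hp⟩).of_dvd (Nat.dvd_ordProj_of_dvd (h.index_ne_zero U) hp hpN)
    have hpζ : p ∣ (ζ ⟨p, hp⟩ : ℕ) := (hmod.dvd_iff dvd_rfl).mp hpZ
    exact hp.one_lt.ne' ((hζ ⟨p, hp⟩).symm.eq_one_of_dvd hpζ)
  constructor
  · refine (injective_iff_map_eq_one f).mpr fun x hx => h.eq_one_of_forall_mem fun U => ?_
    have h1 := hf x U
    rw [hx, mul_one] at h1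
    have h2 := U.inv_mem h1
    rw [inv_inv] at h2
    have := IsTfgProfinite.pow_gcd_mem U h2 (IsTfgProfinite.pow_index_mem U x)
    rwa [(hcop U).gcd_eq_one, pow_one] at this
  · intro y
    have hclosed : IsClosed (Set.range f) := (isCompact_range hfz.continuous).isClosed
    suffices y ∈ closure (Set.range f) by rwa [hclosed.closure_eq] at this
    rw [mem_closure_iff_nhds]
    intro W hW
    obtain ⟨U, hU⟩ := h.exists_openSubgroup_mul_subset hW
    obtain ⟨a, -, ha⟩ := Nat.exists_mul_mod_eq_of_coprime 1 (hcop U) (h.index_ne_zero U)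
    have key : y⁻¹ * f (y ^ a) ∈ U := by
      have h1 := hf (y ^ a) U
      rw [← OpenSubgroup.mem_toSubgroup, ← QuotientGroup.eq] at h1 ⊢
      rw [← h1, ← pow_mul,
        show (QuotientGroup.mk y : M ⧸ (U : Subgroup M)) = QuotientGroup.mk (y ^ 1) by rw [pow_one]]
      refine IsTfgProfinite.mk_pow_eq_mk_pow_of_modEq U y ?_
      rw [mul_comm]
      exact Nat.ModEq.symm ha
    have := hU _ key
    rw [mul_inv_cancel_left] at this
    exact ⟨f (y ^ a), this, y ^ a, rfl⟩

end ZetaPower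

end Literature.AlgebraicGeometry.Frobenioids
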